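import Literature.MathematicalPhysics.QuantumFieldTheory.Balaban1983to89.NodeOLettersSqrt
import Literature.MathematicalPhysics.QuantumFieldTheory.Balaban1983to89.B13Sqrt27AccretiveAlmostLocal

/-!
# `Balaban1983to89.NodeOLettersSqrtAlmostLocal` — the ALMOST-LOCAL twin of `NodeOLettersSqrt.kernelLetters_invSqrt`:
# NODE O's letters (L1)–(L3) for the square-root family `(σ,u) ↦ (P(σ,u))^{−1/2}` of [Balaban1988RG2Cluster] (2.7) p. 13 from
# precision-level letters in which «range one» is replaced by print's «almost local» (p. 13): EXPONENTIALLY WEIGHTED off-diagonal sums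

statement-level bookkeeping over published theorems with citation tags; kernel-checked compositions of tree theorems; nothing here is a
claim about the Yang–Mills mass gap.

Cell `pub-ymgap`, D-0062 Track A, node N10 = [Balaban1988RG2Cluster] Lemmas 1–3; seat `dag-n10-b` g2 (-b), by-name twin of dag-p2 =
n10-a g6's junction `NodeOLettersSqrt` (p424729).  WHY: `kernelLetters_invSqrt` there asks the precision `P(σ,u)` to be of RANGE ONE in an
`ℕ`-pseudo-metric dominating the torus distance; Bałaban's precisions `C*Δ_k(σ,𝐔,𝐉)C` contain the propagators of [13] and are only
exponentially localised (*"almost local"*, p. 13).  With `B13Sqrt27AccretiveAlmostLocal` (almost-local accretive Combes–Thomas) the same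
junction holds under the weighted-sum hypothesis `Σ_l ‖P(σ,u)_{il}‖(e^{κ·d₁(loc i, loc l)} − 1) ≤ ϱ ≤ m/2` directly in the torus distance `d₁`.

CITATION.  [Balaban1988RG2Cluster] p. 13: *"This term determines a nonnegative, bounded and almost local operator … The operator G̃₃(x)
has the same properties as G̃₂ … hence an expansion of (C^{(k)})^{1/2} also."*; p. 15: *"The general case is handled by a perturbative
argument."*; (2.16) p. 16.  [Balaban1985BackgroundPropagators] (3.93) p. 410, Thm 3.10 p. 416.

WHAT THIS FILE PROVES (0 `sorry`, 0 `def`, standard axioms): **`kernelLetters_invSqrt_almostLocal`** — UNIFORMLY on polydisc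
`‖σ_j‖ ≤ e^{κ₁}` × ball `‖u‖ < R`: `P(σ,u)` `m`-accretive with `(e^{κd₁} − 1)`-weighted off-diagonal row/column sums `≤ ϱ ≤ m/2`
(`κ ≥ 0`), σ-localisation of `P` at the reference through `X` (`‖(P(σ,0) − P(0,0))_{kl}‖ ≤ B₀e^{−ρ₀ d_X}`), entrywise `u`-holomorphy of
`P(σ,·)`, volume sums `Σ_k e^{−η d₁(loc i, loc k)} ≤ c_V` (`η ≥ 0`), and `0 ≤ θ′ ≤ ρ₀`, `θ′ + η ≤ κ` ⟹
`KernelLetters c locΛ locΛ (fun σ u => invSqrt (P σ u)) X R θ′ (4/√m) (16B₀c_V²/(m√m))`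
(decay ← `norm_invSqrt_apply_le_almostLocal`; sigmaLoc ← `norm_invSqrt_sub_apply_le_almostLocal` with the weight `D := d_X(loc ·, loc ·)`
and `NodeOLettersSqrt.distX_le_tdist1_add`; holo ← `B13Sqrt27Accretive.differentiableOn_invSqrt_apply`).
HONEST FRAMING: finite-matrix bookkeeping joining tree interfaces by name; nothing of Bałaban's operators constructed; whether HIS precision
meets the weighted-sum letters with k-uniform constants is object-level content of [13] ∕ G-B9-10 ∕ the pin; the σ-polydisc smallness
`O(1)e^{−⅓δ₀M}` of (2.16) (walks) NOT treated; count-neutral; NOT NODE O; nothing continuum ∕ ℝ⁴ ∕ OS ∕ mass-gap ∕ Clay.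
-/

noncomputable section

namespace Literature.MathematicalPhysics.QuantumFieldTheory.Balaban1983to89.NodeOLettersSqrtAlmostLocal

open Metric Set Finset
open scoped Matrix
open Literature.MathematicalPhysics.QuantumFieldTheory.Balaban1983to89
open Literature.MathematicalPhysics.QuantumFieldTheory.Balaban1983to89.B9Thm37GlueTorus
  (tdist1 tdist1_nonneg tdist1_triangle tdist1_self tdist1_comm)
open Literature.MathematicalPhysics.QuantumFieldTheory.Balaban1983to89.TreeLengthTorus (TPt)
open Literature.MathematicalPhysics.QuantumFieldTheory.Balaban1983to89.B5TorusCover (UT)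
open Literature.MathematicalPhysics.QuantumFieldTheory.Balaban1983to89.NodeOLetters (distX distX_eq distX_nonneg KernelLetters)
open Literature.MathematicalPhysics.QuantumFieldTheory.Balaban1983to89.NodeOLettersSqrt (distX_le_tdist1_add)
open Literature.MathematicalPhysics.QuantumFieldTheory.Balaban1983to89.B13Sqrt27Accretive
  (invSqrt differentiableOn_invSqrt_apply)
open Literature.MathematicalPhysics.QuantumFieldTheory.Balaban1983to89.B13Sqrt27AccretiveAlmostLocal
  (norm_invSqrt_apply_le_almostLocal norm_invSqrt_sub_apply_le_almostLocal)

variable {d N' : ℕ} {ν : ℕ} {Nf : Fin ν → ℕ} [∀ i, NeZero (Nf i)]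
variable {Λ : Type} [Fintype Λ] [DecidableEq Λ]
variable {E : Type*} [NormedAddCommGroup E] [NormedSpace ℂ E]

omit [∀ i, NeZero (Nf i)] in
/-- `σ = 0` lies in the polydisc `‖σ_j‖ ≤ e^{κ₁}` (plumbing). [folklore] -/
private theorem zero_mem_polydisc (c : B13.Consts) : ∀ j, ‖(0 : TPt d N' → ℂ) j‖ ≤ Real.exp c.κ₁ :=
  fun _ => by simpa using (Real.exp_pos c.κ₁).le

/-- **NODE O's LETTERS (L1)–(L3) FOR THE SQUARE-ROOT FAMILY FROM ALMOST-LOCAL PRECISION LETTERS.**  See the module docstring for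
the hypotheses; the output rate is `θ′` both for the plain decay (`e^{−θ′d₁} ≥ e^{−κd₁}`) and for the σ-localisation through `X`.
[cite: Balaban1988RG2Cluster, (2.7) p.13, p.15, (2.16) p.16] -/
theorem kernelLetters_invSqrt_almostLocal (c : B13.Consts) (locΛ : Λ → UT Nf) {X : Finset (UT Nf)} (hX : X.Nonempty)
    (P : (TPt d N' → ℂ) → E → Matrix Λ Λ ℂ)
    {R m κ ϱ η cV B₀ ρ₀ θ' : ℝ} (hR : 0 < R) (hm : 0 < m) (hκ : 0 ≤ κ) (hϱ : 0 ≤ ϱ) (hϱm : ϱ ≤ m / 2)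
    (hη : 0 ≤ η) (hB₀ : 0 ≤ B₀) (hθ' : 0 ≤ θ') (hθ'ρ : θ' ≤ ρ₀) (hθ'η : θ' + η ≤ κ)
    (hacc : ∀ σ : TPt d N' → ℂ, (∀ j, ‖σ j‖ ≤ Real.exp c.κ₁) → ∀ u ∈ ball (0 : E) R,
      ∀ v : Λ → ℂ, m * ∑ i, ‖v i‖ ^ 2 ≤ (∑ i, star (v i) * (P σ u *ᵥ v) i).re)
    (hrow : ∀ σ : TPt d N' → ℂ, (∀ j, ‖σ j‖ ≤ Real.exp c.κ₁) → ∀ u ∈ ball (0 : E) R,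
      ∀ i, ∑ l, ‖P σ u i l‖ * (Real.exp (κ * tdist1 Nf (locΛ i) (locΛ l)) - 1) ≤ ϱ)
    (hcol : ∀ σ : TPt d N' → ℂ, (∀ j, ‖σ j‖ ≤ Real.exp c.κ₁) → ∀ u ∈ ball (0 : E) R,
      ∀ l, ∑ i, ‖P σ u i l‖ * (Real.exp (κ * tdist1 Nf (locΛ i) (locΛ l)) - 1) ≤ ϱ)
    (hPloc : ∀ σ : TPt d N' → ℂ, (∀ j, ‖σ j‖ ≤ Real.exp c.κ₁) →
      ∀ k l, ‖(P σ 0 - P 0 0) k l‖ ≤ B₀ * Real.exp (-(ρ₀ * distX X (locΛ k) (locΛ l))))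
    (hPholo : ∀ σ : TPt d N' → ℂ, (∀ j, ‖σ j‖ ≤ Real.exp c.κ₁) →
      ∀ i j, DifferentiableOn ℂ (fun u => P σ u i j) (ball (0 : E) R))
    (hvol : ∀ i, ∑ k, Real.exp (-(η * tdist1 Nf (locΛ i) (locΛ k))) ≤ cV)
    (hvol' : ∀ j, ∑ l, Real.exp (-(η * tdist1 Nf (locΛ l) (locΛ j))) ≤ cV) :
    KernelLetters c locΛ locΛ (fun σ u => invSqrt (P σ u)) X R θ' (4 / Real.sqrt m)
      (16 * B₀ * cV ^ 2 / (m * Real.sqrt m)) := by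
  have h0ball : (0 : E) ∈ ball (0 : E) R := mem_ball_self hR
  have h0pd := zero_mem_polydisc (d := d) (N' := N') c
  -- the located torus distance on `Λ` is a real pseudo-metric
  set dd : Λ → Λ → ℝ := fun i j => tdist1 Nf (locΛ i) (locΛ j) with hdd
  have hd0 : ∀ i, dd i i = 0 := fun i => tdist1_self _
  have hds : ∀ i j, dd i j = dd j i := fun i j => tdist1_comm _ _
  have hdt : ∀ i j k, dd i k ≤ dd i j + dd j k := fun i j k => tdist1_triangle _ _ _
  have hdnn : ∀ i j, 0 ≤ dd i j := fun i j => tdist1_nonneg _ _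
  refine ⟨?_, ?_, ?_, div_nonneg (by norm_num) (Real.sqrt_nonneg _), by positivity⟩
  · -- (L1) decay at rate `θ' ≤ κ`
    intro σ hσ u hu i j
    have h1 := norm_invSqrt_apply_le_almostLocal dd hd0 hds hdt (P σ u) hm hκ hϱ hϱm (hacc σ hσ u hu) (hrow σ hσ u hu)
      (hcol σ hσ u hu) i j
    refine h1.trans (mul_le_mul_of_nonneg_left (Real.exp_le_exp.2 (neg_le_neg ?_)) ?_)
    · exact mul_le_mul_of_nonneg_right (by linarith) (tdist1_nonneg _ _)
    · exact div_nonneg (by norm_num) (Real.sqrt_nonneg _)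
  · -- (L2) σ-localisation through `X`, weight `D := d_X(loc ·, loc ·)`
    intro σ hσ i j
    set D : Λ → Λ → ℝ := fun k l => distX X (locΛ k) (locΛ l) with hDdef
    have hD0 : ∀ k l, 0 ≤ D k l := fun k l => distX_nonneg X _ _
    have hD : ∀ i k l j, D i j ≤ dd i k + D k l + dd l j := fun i k l j =>
      distX_le_tdist1_add hX (locΛ i) (locΛ k) (locΛ l) (locΛ j)
    have h2 := norm_invSqrt_sub_apply_le_almostLocal dd hd0 hds hdt hdnn (P σ 0) (P 0 0) hm hκ hϱ hϱm
      (hacc σ hσ 0 h0ball) (hacc 0 h0pd 0 h0ball) (hrow σ hσ 0 h0ball) (hcol σ hσ 0 h0ball) (hrow 0 h0pd 0 h0ball)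
      (hcol 0 h0pd 0 h0ball) D hD0 hD (B := B₀) (ρ := ρ₀) (η := η) (θ' := θ') (cV := cV) hB₀ hθ' hθ'ρ hθ'η
      (hPloc σ hσ) hvol hvol' i j
    rw [← Matrix.sub_apply]
    exact h2
  · -- (L3) holomorphy in the background
    intro σ hσ i j
    exact differentiableOn_invSqrt_apply (fun u => P σ u) hm (fun u hu => hacc σ hσ u hu) (hPholo σ hσ) i j

/-! ## §2 (v1.1, APPEND-ONLY; §1 byte-identical to v1 p427959). `TermLetters` FOR A (2.14)-TERM WHOSE Γ-KERNEL IS «LOCAL FACTOR × SQUARE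
ROOT» — the whole by-name recipe precision letters ⟹ NODE O's `TermLetters` in ONE theorem (then `NodeOLetters.termWalkData_of_letters` ⟹
`TermWalkData` ⟹ `B13TermWalkData.localisation17a_of_termWalkData` ∕ `differences216_of_termWalkData` ⟹ L17a ∧ L16a of (2.26)) -/

/-- Rate monotonicity of the letters: decay and σ-localisation at rate `ρ` persist at any smaller rate `ρ′ ≤ ρ` (non-negative
constants, non-negative distances). [cite: Balaban1988RG2Cluster, (2.16) p.16] -/
theorem kernelLetters_mono_rate {p q : Type} (c : B13.Consts) {locp : p → UT Nf} {locq : q → UT Nf}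
    {K : (TPt d N' → ℂ) → E → Matrix p q ℂ} {X : Finset (UT Nf)} {R ρ ρ' B B' : ℝ} (hle : ρ' ≤ ρ)
    (h : KernelLetters c locp locq K X R ρ B B') : KernelLetters c locp locq K X R ρ' B B' := by
  refine ⟨fun σ hσ u hu i j => (h.decay σ hσ u hu i j).trans ?_, fun σ hσ i j => (h.sigmaLoc σ hσ i j).trans ?_, h.holo,
    h.B_nonneg, h.B'_nonneg⟩
  · exact mul_le_mul_of_nonneg_left (Real.exp_le_exp.2 (neg_le_neg (mul_le_mul_of_nonneg_right hle (tdist1_nonneg _ _))))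
      h.B_nonneg
  · exact mul_le_mul_of_nonneg_left (Real.exp_le_exp.2 (neg_le_neg (mul_le_mul_of_nonneg_right hle (distX_nonneg X _ _))))
      h.B'_nonneg

/-- **`TermLetters` OF A TERM WITH Γ-KERNEL `G2(σ,u) = L(σ,u)·P(σ,u)^{−1/2}` FROM PRIMITIVE LETTERS** (the t2-recipe of the N10 -b hand-over
as one theorem).  Inputs: the term's kernel record `𝒦` (`B13TermWalkData.TermKernels`) with the Γ-kernel READ as a product
`𝒦.G2 σ u = L σ u * invSqrt (P σ u)` ([II] p. 13∕15: `Γ_k(Z₀,σ) = C*Δ_k(σ)C_{Z₀ᶜ}·(C^{(k)})^{1/2}(σ)`); letters of the LOCAL factor `L`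
(`KernelLetters` at rate `≥ ρ₀`); almost-local letters of the full precision `P` on the columns' torus locations (`m`-accretive,
`(e^{κd₁} − 1)`-weighted sums `≤ ϱ ≤ m/2`, σ-localisation through `X`, holomorphy; §1) with `θ′ ≥ ρ₀`; letters of the term's own precision
`𝒦.A2` (`KernelLetters` at rate `≥ ρ′`) together with ITS accretivity `m_A` and weighted sums `≤ ϱ_A ≤ m_A/2` at rate `κ_A` (⟹ the
covariance letter `hC` with `B_C = 4/m_A` by `almostLocal_inverse_decay`); volume sums `c_V` at rate `η ≥ 0` on the three location
pairings; `ρ′ + η ≤ ρ₀`; the geometric clause `hfar`.  Output: `TermLetters 𝒦 R ρ′ κ_A (B_L·(4/√m)·c_V)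
((B_L′·(4/√m) + B_L·16B₀c_V²/(m√m))·c_V) B_E B_E′ (4/m_A) R_σ`. [cite: Balaban1988RG2Cluster, (2.14)–(2.16) pp.15–16, (2.7) p.13] -/
theorem termLetters_of_sqrtFactor {c : B13.Consts} (𝒦 : B13TermWalkData.TermKernels c d N' ν Nf E)
    [Fintype 𝒦.C₀] [DecidableEq 𝒦.C₀] (hX : 𝒦.X.Nonempty)
    (L : (TPt d N' → ℂ) → E → Matrix 𝒦.Λ (𝒦.Λ ⊕ 𝒦.C₀) ℂ)
    (P : (TPt d N' → ℂ) → E → Matrix (𝒦.Λ ⊕ 𝒦.C₀) (𝒦.Λ ⊕ 𝒦.C₀) ℂ)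
    (hG2 : ∀ σ u, 𝒦.G2 σ u = L σ u * invSqrt (P σ u))
    {R ρL BL BL' m κ ϱ B₀ ρ₀P θ' ρE BE BE' mA κA ϱA η cV ρ₀ ρ' Rσ : ℝ}
    (hR : 0 < R) (hη : 0 ≤ η) (hρ' : 0 ≤ ρ') (hsplit : ρ' + η ≤ ρ₀) (hρ₀L : ρ₀ ≤ ρL) (hρ₀S : ρ₀ ≤ θ') (hρE : ρ' ≤ ρE)
    -- letters of the local factor
    (hL : KernelLetters c 𝒦.locΛ 𝒦.locN L 𝒦.X R ρL BL BL')
    -- almost-local letters of the precision `P` (columns' locations)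
    (hm : 0 < m) (hκ : 0 ≤ κ) (hϱ : 0 ≤ ϱ) (hϱm : ϱ ≤ m / 2) (hB₀ : 0 ≤ B₀) (hθ' : 0 ≤ θ') (hθ'ρ : θ' ≤ ρ₀P)
    (hθ'η : θ' + η ≤ κ)
    (hPacc : ∀ σ : TPt d N' → ℂ, (∀ j, ‖σ j‖ ≤ Real.exp c.κ₁) → ∀ u ∈ ball (0 : E) R,
      ∀ v : 𝒦.Λ ⊕ 𝒦.C₀ → ℂ, m * ∑ i, ‖v i‖ ^ 2 ≤ (∑ i, star (v i) * (P σ u *ᵥ v) i).re)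
    (hProw : ∀ σ : TPt d N' → ℂ, (∀ j, ‖σ j‖ ≤ Real.exp c.κ₁) → ∀ u ∈ ball (0 : E) R,
      ∀ i, ∑ l, ‖P σ u i l‖ * (Real.exp (κ * tdist1 Nf (𝒦.locN i) (𝒦.locN l)) - 1) ≤ ϱ)
    (hPcol : ∀ σ : TPt d N' → ℂ, (∀ j, ‖σ j‖ ≤ Real.exp c.κ₁) → ∀ u ∈ ball (0 : E) R,
      ∀ l, ∑ i, ‖P σ u i l‖ * (Real.exp (κ * tdist1 Nf (𝒦.locN i) (𝒦.locN l)) - 1) ≤ ϱ)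
    (hPloc : ∀ σ : TPt d N' → ℂ, (∀ j, ‖σ j‖ ≤ Real.exp c.κ₁) →
      ∀ k l, ‖(P σ 0 - P 0 0) k l‖ ≤ B₀ * Real.exp (-(ρ₀P * distX 𝒦.X (𝒦.locN k) (𝒦.locN l))))
    (hPholo : ∀ σ : TPt d N' → ℂ, (∀ j, ‖σ j‖ ≤ Real.exp c.κ₁) →
      ∀ i j, DifferentiableOn ℂ (fun u => P σ u i j) (ball (0 : E) R))
    -- letters of the term's precision `𝒦.A2`, plus its accretivity and almost-locality (for the covariance letter)
    (hE : KernelLetters c 𝒦.locΛ 𝒦.locΛ 𝒦.A2 𝒦.X R ρE BE BE')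
    (hmA : 0 < mA) (hκA : 0 ≤ κA) (hϱA : 0 ≤ ϱA) (hϱAm : ϱA ≤ mA / 2)
    (hAacc : ∀ σ : TPt d N' → ℂ, (∀ j, ‖σ j‖ ≤ Real.exp c.κ₁) → ∀ u ∈ ball (0 : E) R,
      ∀ v : 𝒦.Λ → ℂ, mA * ∑ i, ‖v i‖ ^ 2 ≤ (∑ i, star (v i) * (𝒦.A2 σ u *ᵥ v) i).re)
    (hArow : ∀ σ : TPt d N' → ℂ, (∀ j, ‖σ j‖ ≤ Real.exp c.κ₁) → ∀ u ∈ ball (0 : E) R,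
      ∀ i, ∑ l, ‖𝒦.A2 σ u i l‖ * (Real.exp (κA * tdist1 Nf (𝒦.locΛ i) (𝒦.locΛ l)) - 1) ≤ ϱA)
    (hAcol : ∀ σ : TPt d N' → ℂ, (∀ j, ‖σ j‖ ≤ Real.exp c.κ₁) → ∀ u ∈ ball (0 : E) R,
      ∀ l, ∑ i, ‖𝒦.A2 σ u i l‖ * (Real.exp (κA * tdist1 Nf (𝒦.locΛ i) (𝒦.locΛ l)) - 1) ≤ ϱA)
    -- volume sums at rate `η`
    (hvolN : ∀ i : 𝒦.Λ ⊕ 𝒦.C₀, ∑ k : 𝒦.Λ ⊕ 𝒦.C₀, Real.exp (-(η * tdist1 Nf (𝒦.locN i) (𝒦.locN k))) ≤ cV)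
    (hvolN' : ∀ j : 𝒦.Λ ⊕ 𝒦.C₀, ∑ l : 𝒦.Λ ⊕ 𝒦.C₀, Real.exp (-(η * tdist1 Nf (𝒦.locN l) (𝒦.locN j))) ≤ cV)
    (hvolΛN : ∀ i : 𝒦.Λ, ∑ k : 𝒦.Λ ⊕ 𝒦.C₀, Real.exp (-(η * tdist1 Nf (𝒦.locΛ i) (𝒦.locN k))) ≤ cV) (hcV : 0 ≤ cV)
    -- geometry
    (hfar : ∀ b : 𝒦.Λ, ∀ z ∈ 𝒦.X, Rσ ≤ tdist1 Nf (𝒦.locΛ b) z) :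
    NodeOLetters.TermLetters 𝒦 R ρ' κA (BL * (4 / Real.sqrt m) * cV)
      ((BL' * (4 / Real.sqrt m) + BL * (16 * B₀ * cV ^ 2 / (m * Real.sqrt m))) * cV) BE BE' (4 / mA) Rσ := by
  -- the square-root factor's letters (§1), on the columns' locations
  have hS : KernelLetters c 𝒦.locN 𝒦.locN (fun σ u => invSqrt (P σ u)) 𝒦.X R θ' (4 / Real.sqrt m)
      (16 * B₀ * cV ^ 2 / (m * Real.sqrt m)) :=
    kernelLetters_invSqrt_almostLocal c 𝒦.locN hX P hR hm hκ hϱ hϱm hη hB₀ hθ' hθ'ρ hθ'η hPacc hProw hPcol hPloc hPholo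
      hvolN hvolN'
  -- both factors at the common rate `ρ₀`, then the product at rate `ρ'`
  have hL₀ := kernelLetters_mono_rate c hρ₀L hL
  have hS₀ := kernelLetters_mono_rate c hρ₀S hS
  have hprod := NodeOLettersSqrt.kernelLetters_mul c hX hR hρ' hη hsplit hcV hL₀ hS₀ hvolΛN hvolN'
  -- `𝒦.G2` is that product
  have hG : 𝒦.G2 = fun σ u => L σ u * invSqrt (P σ u) := funext fun σ => funext fun u => hG2 σ u
  have hΓ : KernelLetters c 𝒦.locΛ 𝒦.locN 𝒦.G2 𝒦.X R ρ' (BL * (4 / Real.sqrt m) * cV)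
      ((BL' * (4 / Real.sqrt m) + BL * (16 * B₀ * cV ^ 2 / (m * Real.sqrt m))) * cV) := by
    rw [hG]; exact hprod
  -- the covariance letter from the almost-local Combes–Thomas bound
  have hC : ∀ σ : TPt d N' → ℂ, (∀ j, ‖σ j‖ ≤ Real.exp c.κ₁) → ∀ u ∈ ball (0 : E) R,
      ∀ i j, ‖(𝒦.A2 σ u)⁻¹ i j‖ ≤ 4 / mA * Real.exp (-(κA * tdist1 Nf (𝒦.locΛ i) (𝒦.locΛ j))) := by
    intro σ hσ u hu i j
    exact (B13Sqrt27AccretiveAlmostLocal.almostLocal_inverse_decay (fun a b => tdist1 Nf (𝒦.locΛ a) (𝒦.locΛ b))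
      (fun a => tdist1_self _) (fun a b => tdist1_comm _ _) (fun a b e => tdist1_triangle _ _ _) (𝒦.A2 σ u) hmA hκA
      hϱA hϱAm (hAacc σ hσ u hu) (hArow σ hσ u hu) (hAcol σ hσ u hu)).2 i j
  exact ⟨hX, hΓ, kernelLetters_mono_rate c hρE hE, hC, by positivity, hfar⟩

end Literature.MathematicalPhysics.QuantumFieldTheory.Balaban1983to89.NodeOLettersSqrtAlmostLocal

end
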